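import Literature.MathematicalPhysics.QuantumFieldTheory.Balaban1983to89.B9Thm312WholeBlocksPairM
import Literature.MathematicalPhysics.QuantumFieldTheory.Balaban1983to89.B9Thm312WholeHZ
import Literature.MathematicalPhysics.QuantumFieldTheory.Balaban1983to89.B9Thm312WholeStepRegular

/-!
# `Balaban1983to89.B9Thm312WholeBlocksRegular` — [B9] Theorem 3.12 (3.46): THE L² BLOCK OF A KERNEL FAMILY CO-READ BY A ∈ {G, G₁}, FROM THE SUP MEMBERS OF A
# (not from the raw-state steps) — `B9Thm312WholeBlocksNbrRec.blockBds_of_step` ∕ `B9Thm312WholeBlocksPairM.l2Block_of_step_pairM` cut at the member line, so that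
# the members may come from the REGULAR state (`B9Thm312WholeMembersRegular`) — LOCATED-U8′

T. Bałaban, *Propagators for lattice gauge theories in a background field*, Commun. Math. Phys. **99** (1985) 389–434 [`Balaban1985BackgroundPropagators`,
"B9"]; [4] = T. Bałaban, *Propagators and renormalization transformations for lattice gauge theories. II*, Commun. Math. Phys. **96** (1984) 223–250
[`Balaban1984PropagatorsII`].  statement-level skeleton of published theorems with citation tags; proofs where landed; nothing here is a claim about the
Yang–Mills mass gap.  Sequel of `B9Thm312WholeBlocksNbrRec` ∕ `B9Thm312WholeBlocksPairM` (dag-n06-l g5–g6).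

THE PRINT.  (3.46) p. 398 (the six block-L² lines of a propagator: A, ∇_UA, A∇\*_U, ∇∇A, ∇A∇\*, A∇\*∇\* with the weights (Lʲη)², Lʲη, Lʲη, 1, 1, 1); Thm 3.12
p. 423 (G and G₁ satisfy (3.42)–(3.47)); p. 422: convergence of (3.130) «in all norms appearing on the left-hand sides of (3.42)–(3.47)».

THE POINT (dag-n06-l LOCATED-U8′).  `blockBds_of_step` derives the L² lines 0, 1, 2 of A by Schur's test from the SUP members |Aλ|, |∇_UAλ|, |A∇\*_UJ| (`l2bd_entry0_of_sup`,
`l2bd_entry12_of_sup`), and obtains those members from the raw-state steps `hK1 hK2 hKD` — beyond print for A = G₁ at Δ⁽²⁾ ≠ 0.  THIS FILE takes the three sup members AS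
HYPOTHESES (`hm0 hm1 hm2`, printed shapes C₀(Lʲη)²e^{−ρd}, C₁Lʲηe^{−ρd}; for G they are today's `entry0_of_step ∕ entry1_of_stepD ∕ entry2_of_step`, for G₁ the regular-state
members `entry0_of_stateS ∕ entry1_of_stateS ∕ entry2_of_stateS`), keeps the L²-only lines 3, 4, 5 (`l2bd_mixedFamily_of_step`, `blockBds_of_step`'s family lines are re-derived
from `l2bd_family3_of_step ∕ l2bd_family5_of_step` — block-L² bounds of T = Δ′_π + Δ⁽²⁾_π are (3.46)-legitimate, the sandwich D_UG′D\*_U is bounded in L²), and reads the six lines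
on the neighbourhood exactly as `l2Block_of_step_pairM`.  The constant is ANY `KL` dominating the five pieces (`hKLa hKLb hKL3 hKL3' hKL5`).
* §1 ★★ `l2Block_of_members_pairM` — `L2Block K (mN·m·Cev·CL²·e^{rρ_f}·KL) ρ_f U`.
* §2 THE H-WORDS OF (3.126)∕(3.129) THROUGH A REGULAR STATE (`B9Thm312WholeHZ.H_entry0Z ∕ hkh_cNormRZ ∕ hkh_of_step_nbrZ` with the raw class 𝔠⁽²⁾ of the resolvent
  replaced by a free 𝔖): ★ `H_entry0_of_stateS` (H = A∘(Q\*C) : 𝔠_Z⁽²⁾ → 𝔖 — g26 `hasMaj_right_of_stepS` with the producer G₀Q\* INTO 𝔖), `H_read_of_stateS` (read back to 𝔠⁽²⁾: today's `hH0m ∕ hH10m`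
  shape), ★ `hkh_cNormR_stateZ` ∕ ★★ `hkh_of_state_nbrZ` (the Hölder member of (3.133) for H ∕ H₁ on the neighbourhood from the probe of the left step OUT OF 𝔖 and H INTO 𝔖).
HONEST SCOPE.  Bookkeeping; every member, step bound, reading and Theorem-3.3 line enters as a HYPOTHESIS; nothing of [B9]∕[4] asserted; no pin, no certificate edit;
COUNT-NEUTRAL; N06 NOT discharged; one finite lattice at a time — nothing continuum ∕ OS ∕ mass gap.  Cell `pub-ymgap` (HUMAN RULING D-0062), Track A node N06 [B9],
bundle F7 rows 20–21, seat `pub-ymgap-dag-n06-l` (g27), 2026-08-29.  NEW file; nothing landed is modified.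
-/

namespace Literature.MathematicalPhysics.QuantumFieldTheory.Balaban1983to89.B9Thm312WholeBlocksRegular

open Literature.MathematicalPhysics.QuantumFieldTheory.Balaban1983to89
open Finset B6RandomWalk B6RandomWalkHom B9Thm34Ext B9Thm37Glue B9Thm37GlueCor36 B11SectG B9SectDSup B9SectDL2Decay
open B9Thm37AllNorms B9Thm37AllNormsInstances B9FromB6 B9FromB6ModelSignsOn B9SectBStepWhole B9Thm312Whole B9Thm312WholeLeaf
open B9Thm312WholeLeft B9RWSums343Holder B9RWSums346Schur B9RWSumsReadsRel B9RWSumsReadsNbr B9Ineq347 B9Thm312WholeClasses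
open B9Thm312WholeHolder B9Thm312WholeL2 B9Thm312WholeBlocksRel B9RWSums346SecondDiff B9Thm312WholeBlocksNbr B9Thm312WholeBlocksNbrRec
open B9RWSums344InputFam B9Thm312WholeDir B9Thm312WholeBlocksPairM
open B9Thm312WholeH B9CoRealizesHRel B9Thm312WholeHHolder B9Thm312WholeHHolderNbr B9Thm312WholeHZ B9Thm312WholeStepRegular

noncomputable section

variable {g : B9.Geometry} {B : B9.Backgrounds} {X Y Z W P : Type}
variable [Fintype X] [Fintype Y] [Fintype P] [Fintype g.Site] [DecidableEq g.Site]
variable {R₀ : ℝ} {H₀ : Prop}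

/-! ## §1 The L² block from the sup members -/

/-- ★★ **THEOREM 3.12 — THE L² BLOCK (3.46) OF A KERNEL FAMILY CO-READ BY A ∈ {G, G₁}, PAIR-M FACE, FROM THE SUP MEMBERS OF A** (`l2Block_of_step_pairM` with the raw-state
steps `hK1 hK2 hKD` replaced by the three printed sup members they were only used to produce).  Data at U: A = G₀ + G₀TA; the sup members |Aλ| ≦ C₀(Lʲη)²e^{−ρd}|λ| (`hm0`),
|∇_UAλ|, |A∇\*_UJ| ≦ C₁Lʲηe^{−ρd}|·| (`hm1 hm2`); Theorem 3.3's block-L² lines for G₀ with the direction-indexed members (`hL2`); the block-L² bound of T (`hT2`, θ₂); A symmetric,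
(∇_UA)ᵀ = A∇\*_U; [4] Lemma 2.1 as the row sum at σ and three scale transfers (γ = 1, ½, −1); the six co-readings `L2ReadsNbr`; ANY constant `KL ≧ 0` with `C₀Λ₁ ≦ KL`, `C₁Λ_h ≦ KL`,
`N_P·K₄ ≦ KL`, `N_P·K₄·Λ₁ ≦ KL`, `N_P·K₄·Λ_m ≦ KL` (K₄ = B₂ + B₂θ₂B₂(1 − B₂θ₂c²)⁻¹c², N_P = √|P×P|).  Provisos: ρ ≦ δ₀, B₂θ₂c² < 1, 0 ≦ ρ_f, ρ_f + σ ≦ (1 − α)ρ, ρ_f + 2σ + αρ ≦ ρ.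
Conclusion: `L2Block K (mN·m·Cev·CL²·e^{rρ_f}·KL) ρ_f U`.
[cite: Balaban1985BackgroundPropagators, Thm 3.12 p.423 + Thm 3.3 p.399 + (3.46) p.398 + (3.39) p.397 + (3.130) p.421 + (3.138) p.423; Balaban1984PropagatorsII, (2.51)–(2.52) p.232 + Lemma 2.1 (2.60)–(2.61) p.234] -/
theorem l2Block_of_members_pairM (hG : GeoOK g) {K : B9.KernelFamily g B} {U : B.Cfg} (𝔬 : Ops g B X Y Z W)
    (Dd Dds : B.Cfg → P → Module.End ℝ (X → ℝ)) (Rel : g.Site → g.Site → Prop) [DecidableRel Rel]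
    (ev : g.Loc → X → ℝ) (evY : g.Loc → Y → ℝ) {A T : Module.End ℝ (X → ℝ)} {m mN : ℕ}
    {r Cev CL C₀ C₁ θ₂ B₂ δ₀ δK ρ ρf σ α c Λ₁ Λh Λm KL : ℝ}
    (hrow : RowSum (toB6 g R₀ H₀) σ c)
    (hC₀ : 0 ≤ C₀) (hC₁ : 0 ≤ C₁) (hθ₂ : 0 ≤ θ₂) (hB₂ : 0 ≤ B₂) (hσ : 0 ≤ σ) (hα : 0 ≤ α)
    (hρ : 0 ≤ ρ) (hρS : ρ ≤ δ₀) (hρK : ρ ≤ δK) (hq₂ : B₂ * θ₂ * c * c < 1)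
    (hρf : 0 ≤ ρf) (hρf1 : ρf + σ ≤ (1 - α) * ρ) (hρf2 : ρf + 2 * σ + α * ρ ≤ ρ)
    (hΛ₁ : 0 ≤ Λ₁) (hΛm : 0 ≤ Λm)
    (hST1 : ScaleTransfer g ρ α Λ₁ (fun y => g.len y ^ (1 : ℝ)))
    (hSTh : ScaleTransfer g ρ α Λh (fun y => g.len y ^ (1 / 2 : ℝ)))
    (hSTm : ScaleTransfer g ρ α Λm (fun y => g.len y ^ (-1 : ℝ)))
    (hfix : A = 𝔬.G0 U + 𝔬.G0 U ∘ₗ T ∘ₗ A)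
    (hm0 : HasMajorant (g := toB6 g R₀ H₀) 𝔬.blk A (fun a b => C₀ * g.len a ^ 2 * Real.exp (-(ρ * g.dist a b))))
    (hm1 : HasMajorantHom (g := toB6 g R₀ H₀) 𝔬.blk 𝔬.blkY (𝔬.D U ∘ₗ A) (fun (a b : g.Site) => C₁ * g.len a * Real.exp (-(ρ * g.dist a b))))
    (hm2 : HasMajorantHom (g := toB6 g R₀ H₀) 𝔬.blkY 𝔬.blk (A ∘ₗ 𝔬.Dstar U) (fun (a b : g.Site) => C₁ * g.len a * Real.exp (-(ρ * g.dist a b))))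
    (hL2 : Thm33G0L2M 𝔬 Dd Dds R₀ H₀ B₂ δ₀ U)
    (hT2 : BlockBd (g := toB6 g R₀ H₀) 𝔬.blk 𝔬.blk T
      (fun (y y' : g.Site) => θ₂ * (g.len y)⁻¹ * (g.len y')⁻¹ * Real.exp (-(δK * g.dist y y'))))
    (hsym : IsTransposePair A A) (htr : IsTransposePair (𝔬.D U ∘ₗ A) (A ∘ₗ 𝔬.Dstar U))
    (hKL0 : 0 ≤ KL) (hKLa : C₀ * Λ₁ ≤ KL) (hKLb : C₁ * Λh ≤ KL)
    (hKL3 : Real.sqrt (Fintype.card (P × P)) * (B₂ + B₂ * (θ₂ * (B₂ * (1 - B₂ * θ₂ * c * c)⁻¹) * c) * c) ≤ KL)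
    (hKL3' : Real.sqrt (Fintype.card (P × P)) * (B₂ + B₂ * (θ₂ * (B₂ * (1 - B₂ * θ₂ * c * c)⁻¹) * c) * c) * Λ₁ ≤ KL)
    (hKL5 : Real.sqrt (Fintype.card (P × P)) * (B₂ + B₂ * (θ₂ * (B₂ * (1 - B₂ * θ₂ * c * c)⁻¹) * c) * c) * Λm ≤ KL)
    (hRd₂ : ∀ a b b', Rel b b' → g.dist a b = g.dist a b')
    (hmult : ∀ y' : g.Site, (Finset.univ.filter (fun y'' => Rel y'' y')).card ≤ m)
    (hnbr : ∀ y : g.Site, (nbr g r y).card ≤ mN)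
    (hCL1 : 1 ≤ CL) (hCL : ∀ a a' : g.Site, g.dist a a' ≤ r → g.len a ≤ CL * g.len a') (hCev : 0 ≤ Cev)
    (hl0 : L2ReadsNbr (R := R₀) (H := H₀) K 0 U Rel r Cev 𝔬.blk 𝔬.blk ev A)
    (hl1 : L2ReadsNbr (R := R₀) (H := H₀) K 1 U Rel r Cev 𝔬.blkY 𝔬.blk ev (𝔬.D U ∘ₗ A))
    (hl2 : L2ReadsNbr (R := R₀) (H := H₀) K 2 U Rel r Cev 𝔬.blk 𝔬.blkY evY (A ∘ₗ 𝔬.Dstar U))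
    (hl3 : L2ReadsNbr (R := R₀) (H := H₀) K 3 U Rel r Cev (𝔬.blk ∘ Prod.fst) 𝔬.blk ev
      (familyOp (fun q : P × P => Dd U q.1 ∘ₗ (A ∘ₗ Dds U q.2))))
    (hl4 : L2ReadsNbr (R := R₀) (H := H₀) K 4 U Rel r Cev (𝔬.blk ∘ Prod.fst) 𝔬.blk ev
      (familyOp (fun q : P × P => (Dd U q.1 ∘ₗ Dd U q.2) ∘ₗ A)))
    (hl5 : L2ReadsNbr (R := R₀) (H := H₀) K 5 U Rel r Cev (𝔬.blk ∘ Prod.fst) 𝔬.blk ev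
      (familyOp (fun q : P × P => A ∘ₗ (Dds U q.1 ∘ₗ Dds U q.2)))) :
    L2Block K (mN * m * Cev * CL ^ 2 * Real.exp (r * ρf) * KL) ρf U := by
  -- adapted from `B9Thm312WholeBlocksPairM.l2Block_of_step_pairM` + `B9Thm312WholeBlocksNbrRec.blockBds_of_step` (lines 0, 1, 2 from the members)
  have hc : 0 ≤ c ∨ IsEmpty g.Site := by
    by_cases hne : Nonempty g.Site
    · exact Or.inl (hrow.nonneg hne.some)
    · exact Or.inr (not_nonempty_iff.mp hne)
  rcases hc with hc | hemp
  swap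
  · exact fun n lam h y => (hemp.false y).elim
  set NP : ℝ := Real.sqrt (Fintype.card (P × P)) with hNP
  have hNP0 : 0 ≤ NP := Real.sqrt_nonneg _
  set K₄ : ℝ := B₂ + B₂ * (θ₂ * (B₂ * (1 - B₂ * θ₂ * c * c)⁻¹) * c) * c with hK₄
  have hq₂1 : 0 ≤ (1 - B₂ * θ₂ * c * c)⁻¹ := inv_nonneg.mpr (by linarith)
  have hK₄0 : 0 ≤ K₄ := add_nonneg hB₂ (mul_nonneg (mul_nonneg hB₂ (mul_nonneg (mul_nonneg hθ₂ (mul_nonneg hB₂ hq₂1)) hc)) hc)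
  -- rates
  have hαρ : 0 ≤ α * ρ := mul_nonneg hα hρ
  have hρf_le : ρf ≤ (1 - α) * ρ := by linarith
  have hρL0 : 0 ≤ ρf + α * ρ := add_nonneg hρf hαρ
  have hρL2 : ρf + α * ρ + 2 * σ ≤ ρ := by linarith
  have hexp : ∀ {r₁ r' : ℝ}, r' ≤ r₁ → ∀ y y' : g.Site, Real.exp (-(r₁ * g.dist y y')) ≤ Real.exp (-(r' * g.dist y y')) :=
    fun h y y' => Real.exp_le_exp.mpr (neg_le_neg (mul_le_mul_of_nonneg_right h (hG.dnn y y')))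
  -- lines 0, 1, 2 by Schur from the sup members
  have hb0 := l2bd_entry0_of_sup (R₀ := R₀) (H₀ := H₀) hG hC₀ hST1 hm0 hsym
  obtain ⟨hb1, hb2⟩ := l2bd_entry12_of_sup (R₀ := R₀) (H₀ := H₀) hG hC₁ hSTh hm1 hm2 htr
  -- Theorem 3.3's L² lines and the step's L² bound brought to the common rate ρ
  have hL2ρ : Thm33G0L2M 𝔬 Dd Dds R₀ H₀ B₂ ρ U := by
    have hl : ∀ y : g.Site, 0 ≤ g.len y := hG.lenle
    have hli : ∀ y : g.Site, 0 ≤ (g.len y)⁻¹ := fun y => inv_nonneg.mpr (hl y)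
    exact
      { l0 := hL2.l0.mono fun y y' => mul_le_mul_of_nonneg_left (hexp hρS y y') (mul_nonneg (mul_nonneg hB₂ (hl y)) (hl y'))
        l1 := hL2.l1.mono fun y y' => mul_le_mul_of_nonneg_left (hexp hρS y y') (mul_nonneg hB₂ (hl y'))
        l2 := hL2.l2.mono fun y y' => mul_le_mul_of_nonneg_left (hexp hρS y y') (mul_nonneg hB₂ (hl y))
        l3 := fun q => (hL2.l3 q).mono fun y y' =>
          mul_le_mul_of_nonneg_left (hexp hρS y y') (mul_nonneg hB₂ (mul_nonneg (hli y) (hl y')))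
        l4 := hL2.l4.mono fun y y' => mul_le_mul_of_nonneg_left (hexp hρS y y') hB₂
        l5 := fun q => (hL2.l5 q).mono fun y y' =>
          mul_le_mul_of_nonneg_left (hexp hρS y y') (mul_nonneg hB₂ (mul_nonneg (hl y) (hli y')))
        l1d := fun ν => (hL2.l1d ν).mono fun y y' => mul_le_mul_of_nonneg_left (hexp hρS y y') (mul_nonneg hB₂ (hl y'))
        l2d := fun μ => (hL2.l2d μ).mono fun y y' => mul_le_mul_of_nonneg_left (hexp hρS y y') (mul_nonneg hB₂ (hl y))
        l4m := fun q => (hL2.l4m q).mono fun y y' => mul_le_mul_of_nonneg_left (hexp hρS y y') hB₂ }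
  have hT2ρ : BlockBd (g := toB6 g R₀ H₀) 𝔬.blk 𝔬.blk T
      (fun (y y' : g.Site) => θ₂ * (g.len y)⁻¹ * (g.len y')⁻¹ * Real.exp (-(ρ * g.dist y y'))) :=
    hT2.mono fun y y' => mul_le_mul_of_nonneg_left (hexp hρK y y')
      (mul_nonneg (mul_nonneg hθ₂ (inv_nonneg.mpr (hG.lenle y))) (inv_nonneg.mpr (hG.lenle y')))
  -- lines 3 (mixed pair family), 4 (∇∇A), 5 (A∇\*∇\*) by the second-order Neumann bookkeeping in L² (no sup step)
  have hb3 := l2bd_mixedFamily_of_step hG hrow hB₂ hθ₂ hρL0 hσ hρL2 hL2ρ hT2ρ hfix hq₂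
  have hb4 := l2bd_family3_of_step hG hrow hB₂ hθ₂ hρL0 hσ hρL2 hΛ₁ hST1 hL2ρ.toThm33G0L2P hT2ρ hfix hq₂
  have hb5 := l2bd_family5_of_step hG hrow hB₂ hθ₂ hρL0 hσ hρL2 hΛm hSTm hL2ρ.toThm33G0L2P hT2ρ hfix hq₂
  have hρL' : ρf + α * ρ - α * ρ = ρf := by ring
  rw [hρL'] at hb4 hb5
  -- all six at (KL, ρf) in the pref6 shapes
  have hP : ∀ t : ℝ, B9.pref6 t 0 = t ^ 2 ∧ B9.pref6 t 1 = t ∧ B9.pref6 t 2 = t ∧ B9.pref6 t 3 = 1 ∧ B9.pref6 t 4 = 1 ∧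
      B9.pref6 t 5 = 1 := fun t => by simp [B9.pref6]
  have hw : ∀ {Kx r₁ : ℝ} (Pw : g.Site → ℝ), (∀ y, 0 ≤ Pw y) → Kx ≤ KL → ρf ≤ r₁ →
      ∀ y y' : g.Site, Kx * Pw y * Real.exp (-(r₁ * g.dist y y')) ≤ KL * Pw y * Real.exp (-(ρf * g.dist y y')) :=
    fun Pw hPw hK hr₁ y y' => mul_le_mul (mul_le_mul_of_nonneg_right hK (hPw y)) (hexp hr₁ y y') (Real.exp_nonneg _)
      (mul_nonneg hKL0 (hPw y))
  have hB0 : BlockBd (g := toB6 g R₀ H₀) 𝔬.blk 𝔬.blk A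
      (fun (y y' : g.Site) => KL * B9.pref6 (g.len y) 0 * Real.exp (-(ρf * g.dist y y'))) := by
    refine hb0.mono fun y y' => ?_
    rw [(hP (g.len y)).1]
    have h := hw (Kx := C₀ * Λ₁) (r₁ := (1 - α) * ρ) (fun y => g.len y ^ 2) (fun y => sq_nonneg _) hKLa hρf_le y y'
    simpa only [mul_assoc] using h
  have hB1 : BlockBd (g := toB6 g R₀ H₀) 𝔬.blk 𝔬.blkY (𝔬.D U ∘ₗ A)
      (fun (y y' : g.Site) => KL * B9.pref6 (g.len y) 1 * Real.exp (-(ρf * g.dist y y'))) := by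
    refine hb1.mono fun y y' => ?_
    rw [(hP (g.len y)).2.1]
    have h := hw (Kx := C₁ * Λh) (r₁ := (1 - α) * ρ) (fun y => g.len y) hG.lenle hKLb hρf_le y y'
    simpa only [mul_assoc] using h
  have hB2 : BlockBd (g := toB6 g R₀ H₀) 𝔬.blkY 𝔬.blk (A ∘ₗ 𝔬.Dstar U)
      (fun (y y' : g.Site) => KL * B9.pref6 (g.len y) 2 * Real.exp (-(ρf * g.dist y y'))) := by
    refine hb2.mono fun y y' => ?_
    rw [(hP (g.len y)).2.2.1]
    have h := hw (Kx := C₁ * Λh) (r₁ := (1 - α) * ρ) (fun y => g.len y) hG.lenle hKLb hρf_le y y'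
    simpa only [mul_assoc] using h
  have hB3 : BlockBd (g := toB6 g R₀ H₀) 𝔬.blk (𝔬.blk ∘ Prod.fst) (familyOp (fun q : P × P => Dd U q.1 ∘ₗ (A ∘ₗ Dds U q.2)))
      (fun (y y' : g.Site) => KL * B9.pref6 (g.len y) 3 * Real.exp (-(ρf * g.dist y y'))) := by
    refine hb3.mono fun y y' => ?_
    rw [(hP (g.len y)).2.2.2.1, mul_one]
    calc NP * (K₄ * Real.exp (-((ρf + α * ρ) * g.dist y y'))) = NP * K₄ * Real.exp (-((ρf + α * ρ) * g.dist y y')) := by ring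
      _ ≤ KL * Real.exp (-(ρf * g.dist y y')) := mul_le_mul hKL3 (hexp (by linarith) y y') (Real.exp_nonneg _) hKL0
  have hB4 : BlockBd (g := toB6 g R₀ H₀) 𝔬.blk (𝔬.blk ∘ Prod.fst) (familyOp (fun q : P × P => (Dd U q.1 ∘ₗ Dd U q.2) ∘ₗ A))
      (fun (y y' : g.Site) => KL * B9.pref6 (g.len y) 4 * Real.exp (-(ρf * g.dist y y'))) := by
    refine hb4.mono fun y y' => ?_
    rw [(hP (g.len y)).2.2.2.2.1, mul_one]
    calc NP * (K₄ * Λ₁ * Real.exp (-(ρf * g.dist y y'))) = NP * K₄ * Λ₁ * Real.exp (-(ρf * g.dist y y')) := by ring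
      _ ≤ KL * Real.exp (-(ρf * g.dist y y')) := mul_le_mul_of_nonneg_right hKL3' (Real.exp_nonneg _)
  have hB5 : BlockBd (g := toB6 g R₀ H₀) 𝔬.blk (𝔬.blk ∘ Prod.fst) (familyOp (fun q : P × P => A ∘ₗ (Dds U q.1 ∘ₗ Dds U q.2)))
      (fun (y y' : g.Site) => KL * B9.pref6 (g.len y) 5 * Real.exp (-(ρf * g.dist y y'))) := by
    refine hb5.mono fun y y' => ?_
    rw [(hP (g.len y)).2.2.2.2.2, mul_one]
    calc NP * (K₄ * Λm * Real.exp (-(ρf * g.dist y y'))) = NP * K₄ * Λm * Real.exp (-(ρf * g.dist y y')) := by ring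
      _ ≤ KL * Real.exp (-(ρf * g.dist y y')) := mul_le_mul_of_nonneg_right hKL5 (Real.exp_nonneg _)
  intro n
  fin_cases n
  · exact l2line_of_blockBd_nbr hl0 hRd₂ hmult hnbr hCL1 hCL hG.tri hG.symm hKL0 hρf hCev hG.lenle hB0
  · exact l2line_of_blockBd_nbr hl1 hRd₂ hmult hnbr hCL1 hCL hG.tri hG.symm hKL0 hρf hCev hG.lenle hB1
  · exact l2line_of_blockBd_nbr hl2 hRd₂ hmult hnbr hCL1 hCL hG.tri hG.symm hKL0 hρf hCev hG.lenle hB2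
  · exact l2line_of_blockBd_nbr hl3 hRd₂ hmult hnbr hCL1 hCL hG.tri hG.symm hKL0 hρf hCev hG.lenle hB3
  · exact l2line_of_blockBd_nbr hl4 hRd₂ hmult hnbr hCL1 hCL hG.tri hG.symm hKL0 hρf hCev hG.lenle hB4
  · exact l2line_of_blockBd_nbr hl5 hRd₂ hmult hnbr hCL1 hCL hG.tri hG.symm hKL0 hρf hCev hG.lenle hB5


/-! ## §2 The H-words of (3.126) ∕ (3.129) through a regular state -/

section HState

variable {Z PX PY : Type} [Fintype Z] [Fintype PY]

omit [Fintype X] [Fintype Y] [Fintype P] [DecidableEq g.Site] in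
/-- ★ **H = A∘(Q\*C) AS A RIGHT ENTRY OF A INTO THE REGULAR STATE** (`B9Thm312WholeHZ.H_entry0Z` with 𝔠⁽²⁾ ↦ 𝔖): the producer G₀Q\* : bZ → 𝔖 (B₃e^{−δ₃d}; at the pins from `gQs2` + the probe
family `hpXQs`) after C : 𝔠_Z⁽²⁾ → bZ (B₃e^{−δ₃d}, (3.132)), `bZ.κ = 1`, the step `G₀T : 𝔖 → 𝔖` (θe^{−δ_K d}), an a-priori majorant and `κ_S·θ·c < 1` give `A∘(Q\*C) : 𝔠_Z⁽²⁾ → 𝔖` the majorant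
B₃²c(1 − κ_Sθc)⁻¹e^{−ρd} (g26 `hasMaj_right_of_stepS`). [cite: Balaban1985BackgroundPropagators, (3.126) p.420 + (3.129) p.421 + (3.132) p.422 + (3.130) p.421 + (3.138) p.423; Balaban1984PropagatorsII, Lemma 2.1 p.234] -/
theorem H_entry0_of_stateS (hG : GeoOK g) {blkZ : Z → g.Site} {bZ : BlockNorm (toB6 g R₀ H₀) (Z → ℝ)} {𝔖 : BlockNorm (toB6 g R₀ H₀) (X → ℝ)}
    {G0 T A : Module.End ℝ (X → ℝ)} {Qs : (Z → ℝ) →ₗ[ℝ] (X → ℝ)} {Cop : Module.End ℝ (Z → ℝ)} {θ B₃ M₀ δ₃ δK ρ σ c : ℝ}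
    (hrow : RowSum (toB6 g R₀ H₀) σ c) (hκ : bZ.κ = 1)
    (hc : 0 ≤ c) (hθ : 0 ≤ θ) (hB₃ : 0 ≤ B₃) (hM₀ : 0 ≤ M₀) (hσ : 0 ≤ σ) (hρ : 0 ≤ ρ) (hρ₃ : ρ + σ ≤ δ₃) (hρδ : ρ + σ ≤ δK)
    (hK : HasMaj 𝔖 𝔖 (G0 ∘ₗ T) (fun a b => θ * Real.exp (-(δK * g.dist a b))))
    (hQs : HasMaj bZ 𝔖 (G0 ∘ₗ Qs) (fun a b => B₃ * Real.exp (-(δ₃ * g.dist a b))))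
    (hCop : HasMaj (cNorm R₀ H₀ blkZ hG.lenle 2) bZ Cop (fun a b => B₃ * Real.exp (-(δ₃ * g.dist a b))))
    (hfix : A = G0 + G0 ∘ₗ T ∘ₗ A) (hap : HasMaj (cNorm R₀ H₀ blkZ hG.lenle 2) 𝔖 (A ∘ₗ (Qs ∘ₗ Cop)) (fun _ _ => M₀))
    (hq : 𝔖.κ * θ * c < 1) :
    HasMaj (cNorm R₀ H₀ blkZ hG.lenle 2) 𝔖 (A ∘ₗ (Qs ∘ₗ Cop))
      (fun a b => B₃ * B₃ * c * (1 - 𝔖.κ * θ * c)⁻¹ * Real.exp (-(ρ * g.dist a b))) := by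
  have htri : Triangle254 (toB6 g R₀ H₀) := fun a b c => hG.tri a b c
  have hS : HasMaj (cNorm R₀ H₀ blkZ hG.lenle 2) 𝔖 (G0 ∘ₗ (Qs ∘ₗ Cop)) (fun a b => bZ.κ * B₃ * B₃ * c * Real.exp (-(ρ * g.dist a b))) :=
    (hasMaj_comp_exp htri hG.dnn hrow hB₃ hB₃ hρ (by linarith) hρ₃ hQs hCop).congr fun μ => rfl
  rw [hκ] at hS
  simp only [one_mul] at hS
  exact hasMaj_right_of_stepS hG hrow hθ (mul_nonneg (mul_nonneg hB₃ hB₃) hc) hM₀ hρ le_rfl hρδ hK hS hfix hap hq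

omit [Fintype Y] [Fintype P] [DecidableEq g.Site] in
/-- **H READ BACK INTO THE RAW CLASS 𝔠⁽²⁾** (today's `hH0m ∕ hH10m` shape): `A∘(Q\*C) : 𝔠_Z⁽²⁾ → 𝔖` (K_H·e^{−ρ_H d}) followed by the sup reading `id : 𝔖 → 𝔠^{(−2)}` (C_R·e^{−r_R d}) is
`H : 𝔠_Z⁽²⁾ → 𝔠⁽²⁾` with κ_S·C_R·K_H·c·e^{−ρd} (g26 `hasMaj_read_of_state`). [cite: Balaban1985BackgroundPropagators, (3.126) p.420 + (3.42) p.397; Balaban1984PropagatorsII, (2.52)–(2.54) pp.232–233 + Lemma 2.1 (2.61) p.234] -/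
theorem H_read_of_stateS (hG : GeoOK g) {blk : X → g.Site} {blkZ : Z → g.Site} {𝔖 : BlockNorm (toB6 g R₀ H₀) (X → ℝ)} {Hop : (Z → ℝ) →ₗ[ℝ] (X → ℝ)}
    {KH ρH CR rR ρ σ c : ℝ} (hrow : RowSum (toB6 g R₀ H₀) σ c) (hKH : 0 ≤ KH) (hCR : 0 ≤ CR) (hρ : 0 ≤ ρ) (hρH : ρ ≤ ρH) (hρR : ρ + σ ≤ rR)
    (hH : HasMaj (cNorm R₀ H₀ blkZ hG.lenle 2) 𝔖 Hop (fun a b => KH * Real.exp (-(ρH * g.dist a b))))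
    (hRd : HasMaj 𝔖 (cNormR R₀ H₀ blk hG.lenle (-2)) LinearMap.id (fun a b => CR * Real.exp (-(rR * g.dist a b)))) :
    HasMaj (cNorm R₀ H₀ blkZ hG.lenle 2) (cNorm R₀ H₀ blk hG.lenle 2) Hop (fun a b => 𝔖.κ * CR * KH * c * Real.exp (-(ρ * g.dist a b))) := by
  have hRd' : HasMaj 𝔖 (cNorm R₀ H₀ blk hG.lenle 2) LinearMap.id (fun a b => CR * Real.exp (-(rR * g.dist a b))) := by
    intro y' μ hμ y
    have hb := hRd y' μ hμ y
    rwa [show (-2 : ℝ) = -((2 : ℕ) : ℝ) by norm_num, cNormR_loc_neg_natCast hG] at hb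
  have h := hasMaj_read_of_state hG hrow hKH hCR hρ hρH hρR hH hRd'
  rwa [LinearMap.id_comp] at h

omit [Fintype X] [Fintype Y] [Fintype P] [DecidableEq g.Site] in
/-- ★ **Φ^Y_β∘∇_U∘H IN THE WEIGHTED CLASSES, THROUGH THE REGULAR STATE** (`B9Thm312WholeHZ.hkh_cNormRZ` with H carried INTO 𝔖 and the probe of the left step read OUT OF 𝔖): the
letter `hpQ` (B_q, `bZ` → 𝔠_P^{(β−1)}) after C (B₃, 𝔠_Z⁽²⁾ → `bZ`, `bZ.κ = 1`), and the probe step `hpY : 𝔖 → 𝔠_P^{(β−1)}` (θ_H, `probeYS_of_lettersS`) after `H : 𝔠_Z⁽²⁾ → 𝔖` (K_H): majorant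
(B_qB₃c + κ_S·θ_HK_Hc)·e^{−ρd} from 𝔠_Z^{(−2)} into 𝔠_P^{(β−1)}. [cite: Balaban1985BackgroundPropagators, (3.133) p.422 + (3.126) p.420 + (3.130) p.421 + (3.132) p.422; Balaban1984PropagatorsII, Lemma 2.1 p.234] -/
theorem hkh_cNormR_stateZ (hG : GeoOK g) {blkZ : Z → g.Site} {blkP : PY → g.Site} {bZ : BlockNorm (toB6 g R₀ H₀) (Z → ℝ)} {𝔖 : BlockNorm (toB6 g R₀ H₀) (X → ℝ)}
    {G0 T A : Module.End ℝ (X → ℝ)} {E : (X → ℝ) →ₗ[ℝ] (PY → ℝ)} {Qs : (Z → ℝ) →ₗ[ℝ] (X → ℝ)} {Cop : Module.End ℝ (Z → ℝ)}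
    {Hop : (Z → ℝ) →ₗ[ℝ] (X → ℝ)} {θH Bq B₃ KH β δ₃ δK ρ σ c : ℝ} (hrow : RowSum (toB6 g R₀ H₀) σ c) (hκ : bZ.κ = 1)
    (hθH : 0 ≤ θH) (hBq : 0 ≤ Bq) (hB₃ : 0 ≤ B₃) (hKH : 0 ≤ KH) (hσ : 0 ≤ σ) (hρ : 0 ≤ ρ) (hρ₃ : ρ + σ ≤ δ₃)
    (hρδ : ρ + σ ≤ δK)
    (hpQ : HasMaj bZ (cNormR R₀ H₀ blkP hG.lenle (β - 1)) ((E ∘ₗ G0) ∘ₗ Qs) (fun a b => Bq * Real.exp (-(δ₃ * g.dist a b))))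
    (hCop : HasMaj (cNorm R₀ H₀ blkZ hG.lenle 2) bZ Cop (fun a b => B₃ * Real.exp (-(δ₃ * g.dist a b))))
    (hpY : HasMaj 𝔖 (cNormR R₀ H₀ blkP hG.lenle (β - 1)) ((E ∘ₗ G0) ∘ₗ T) (fun a b => θH * Real.exp (-(δK * g.dist a b))))
    (hH : HasMaj (cNorm R₀ H₀ blkZ hG.lenle 2) 𝔖 Hop (fun a b => KH * Real.exp (-(ρ * g.dist a b))))
    (hHop : Hop = A ∘ₗ (Qs ∘ₗ Cop)) (hfix : A = G0 + G0 ∘ₗ T ∘ₗ A) :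
    HasMaj (cNormR R₀ H₀ blkZ hG.lenle (-2)) (cNormR R₀ H₀ blkP hG.lenle (β - 1)) (E ∘ₗ Hop)
      (fun a b => (Bq * B₃ * c + 𝔖.κ * θH * KH * c) * Real.exp (-(ρ * g.dist a b))) := by
  -- adapted from `B9Thm312WholeHZ.hkh_cNormRZ` (the middle class 𝔠⁽²⁾ of H freed)
  have htri : Triangle254 (toB6 g R₀ H₀) := fun a b c => hG.tri a b c
  have hC' : HasMaj (cNormR R₀ H₀ blkZ hG.lenle (-2)) bZ Cop (fun a b => B₃ * Real.exp (-(δ₃ * g.dist a b))) := by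
    have h := hasMaj_toR_in hG hCop
    simp only [Nat.cast_ofNat] at h
    exact h
  have hH' : HasMaj (cNormR R₀ H₀ blkZ hG.lenle (-2)) 𝔖 Hop (fun a b => KH * Real.exp (-(ρ * g.dist a b))) := by
    have h := hasMaj_toR_in hG hH
    simp only [Nat.cast_ofNat] at h
    exact h
  have h1 : HasMaj (cNormR R₀ H₀ blkZ hG.lenle (-2)) (cNormR R₀ H₀ blkP hG.lenle (β - 1)) (((E ∘ₗ G0) ∘ₗ Qs) ∘ₗ Cop)
      (fun a b => bZ.κ * Bq * B₃ * c * Real.exp (-(ρ * g.dist a b))) :=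
    hasMaj_comp_exp htri hG.dnn hrow hBq hB₃ hρ (by linarith) hρ₃ hpQ hC'
  rw [hκ] at h1
  simp only [one_mul] at h1
  have h2 : HasMaj (cNormR R₀ H₀ blkZ hG.lenle (-2)) (cNormR R₀ H₀ blkP hG.lenle (β - 1)) (((E ∘ₗ G0) ∘ₗ T) ∘ₗ Hop)
      (fun a b => 𝔖.κ * θH * KH * c * Real.exp (-(ρ * g.dist a b))) :=
    hasMaj_comp_exp htri hG.dnn hrow hθH hKH hρ le_rfl hρδ hpY hH'
  have hsum := h1.add h2
  have hop : E ∘ₗ Hop = ((E ∘ₗ G0) ∘ₗ Qs) ∘ₗ Cop + ((E ∘ₗ G0) ∘ₗ T) ∘ₗ Hop := by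
    rw [hHop]
    conv_lhs => rw [comp_fix_rightEntry (Qs ∘ₗ Cop) hfix]
    rw [LinearMap.comp_add]
    exact LinearMap.ext fun _ => rfl
  rw [← hop] at hsum
  exact hsum.mono fun a b => le_of_eq (by ring)

omit [Fintype X] [Fintype Y] [Fintype P] [DecidableEq g.Site] in
/-- ★★ **THE HÖLDER MEMBER OF (3.133) FOR H (OR H₁), NEIGHBOURHOOD READING, THROUGH THE REGULAR STATE** (`B9Thm312WholeHZ.hkh_of_step_nbrZ` with H INTO 𝔖 and the probe
step OUT OF 𝔖): `Hk.h U β ζ y′ ≦ (CL²·e^{r(1−α)ρ}·C·Λ)·(‖ζ‖^ξ_β + |ζ|)·(Lʲη)^{−(1+β)}·(L^{j′}η)^{−d}·e^{−(1−α)ρd(y,y′)}`, C = B_qB₃c + κ_S·θ_HK_Hc.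
[cite: Balaban1985BackgroundPropagators, (3.133) p.422 + (3.126) p.420 + (3.130) p.421 + p.398 (remark after (3.47)) + p.397 (Δ̃); Balaban1984PropagatorsII, (2.51) p.232 + (2.60) p.234] -/
theorem hkh_of_state_nbrZ (hG : GeoOK g) {Hk : B9.HKernel g B} {U : B.Cfg} {d : ℕ}
    (𝔭 : HolderProbes g B X Y PX PY) {r CL : ℝ} {blkZ : Z → g.Site} {bZ : BlockNorm (toB6 g R₀ H₀) (Z → ℝ)}
    {𝔖 : BlockNorm (toB6 g R₀ H₀) (X → ℝ)} {G0 T A : Module.End ℝ (X → ℝ)} {Dop : (X → ℝ) →ₗ[ℝ] (Y → ℝ)} {Qs : (Z → ℝ) →ₗ[ℝ] (X → ℝ)}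
    {Cop : Module.End ℝ (Z → ℝ)} {Hop : (Z → ℝ) →ₗ[ℝ] (X → ℝ)} {θH Bq B₃ KH β δ₃ δK ρ α Λ σ c : ℝ} (hrow : RowSum (toB6 g R₀ H₀) σ c)
    (hκ : bZ.κ = 1) (hθH : 0 ≤ θH) (hBq : 0 ≤ Bq) (hB₃ : 0 ≤ B₃) (hKH : 0 ≤ KH) (hΛ : 0 ≤ Λ) (hσ : 0 ≤ σ) (hρ : 0 ≤ ρ) (hρ₃ : ρ + σ ≤ δ₃)
    (hρδ : ρ + σ ≤ δK) (hα1 : α ≤ 1) (hβ0 : 0 ≤ β) (hβ1 : β ≤ 1)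
    (hC : CoReadsHHolderNbr Hk U d 𝔭 r blkZ (Dop ∘ₗ Hop))
    (hCL1 : 1 ≤ CL) (hCL : ∀ a a' : g.Site, g.dist a a' ≤ r → g.len a ≤ CL * g.len a')
    (hST : ScaleTransfer g ρ α Λ (fun y => g.len y ^ (2 : ℝ)))
    (hpQ : HasMaj bZ (cNormR R₀ H₀ 𝔭.blkPY hG.lenle (β - 1)) ((𝔭.ΦY U β ∘ₗ Dop ∘ₗ G0) ∘ₗ Qs)
      (fun a b => Bq * Real.exp (-(δ₃ * g.dist a b))))
    (hCop : HasMaj (cNorm R₀ H₀ blkZ hG.lenle 2) bZ Cop (fun a b => B₃ * Real.exp (-(δ₃ * g.dist a b))))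
    (hpY : HasMaj 𝔖 (cNormR R₀ H₀ 𝔭.blkPY hG.lenle (β - 1)) ((𝔭.ΦY U β ∘ₗ Dop ∘ₗ G0) ∘ₗ T) (fun a b => θH * Real.exp (-(δK * g.dist a b))))
    (hH : HasMaj (cNorm R₀ H₀ blkZ hG.lenle 2) 𝔖 Hop (fun a b => KH * Real.exp (-(ρ * g.dist a b))))
    (hHop : Hop = A ∘ₗ (Qs ∘ₗ Cop)) (hfix : A = G0 + G0 ∘ₗ T ∘ₗ A) :
    ∀ (ζ : g.Cut) (y y' : g.Site), g.cutInT ζ y →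
      Hk.h U β ζ y' ≤ (CL ^ 2 * Real.exp (r * ((1 - α) * ρ)) * ((Bq * B₃ * c + 𝔖.κ * θH * KH * c) * Λ)) * g.cutH β ζ *
        (g.len y) ^ (-(1 + β)) * (g.len y') ^ (-(d : ℝ)) * Real.exp (-((1 - α) * ρ * g.dist y y')) := by
  -- the proof of `B9Thm312WholeHZ.hkh_of_step_nbrZ`, with `hkh_cNormR_stateZ` in place of `hkh_cNormRZ`
  intro ζ y y' hζ
  have hc : 0 ≤ c ∨ IsEmpty g.Site := by
    by_cases hne : Nonempty g.Site
    · exact Or.inl (hrow.nonneg hne.some)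
    · exact Or.inr (not_nonempty_iff.mp hne)
  rcases hc with hc | hemp
  swap
  · exact (hemp.false y).elim
  set K : ℝ := Bq * B₃ * c + 𝔖.κ * θH * KH * c with hK
  have hK0 : 0 ≤ K := add_nonneg (mul_nonneg (mul_nonneg hBq hB₃) hc) (mul_nonneg (mul_nonneg (mul_nonneg 𝔖.κ_nonneg hθH) hKH) hc)
  have hW := hkh_cNormR_stateZ (E := 𝔭.ΦY U β ∘ₗ Dop) hG hrow hκ hθH hBq hB₃ hKH hσ hρ hρ₃ hρδ hpQ hCop hpY hH hHop hfix
  have h' := hasMajorantHom_of_hasMaj_cNormR hG (fun a b => mul_nonneg hK0 (Real.exp_nonneg _)) hW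
  have hbound : ∀ a b : g.Site, K * Real.exp (-(ρ * g.dist a b)) * g.len a ^ (-(β - 1)) * g.len b ^ (-2 : ℝ) ≤
      K * Λ * g.len a ^ (-(1 + β)) * Real.exp (-((1 - α) * ρ * g.dist a b)) := by
    intro a b
    have ha : 0 < g.len a := hG.lenpos a
    have hb : 0 < g.len b := hG.lenpos b
    have ht := hST b a
    rw [hG.symm b a] at ht
    have hsplitA : g.len a ^ (-(β - 1)) = g.len a ^ (-(1 + β)) * g.len a ^ (2 : ℝ) := by
      rw [← Real.rpow_add ha]; congr 1; ring
    have hsplit : Real.exp (-(ρ * g.dist a b)) = Real.exp (-((1 - α) * ρ * g.dist a b)) * Real.exp (-(α * ρ * g.dist a b)) := by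
      rw [← Real.exp_add]; congr 1; ring
    have hratio : Real.exp (-(α * ρ * g.dist a b)) * g.len a ^ (2 : ℝ) * g.len b ^ (-2 : ℝ) ≤ Λ := by
      rw [Real.rpow_neg hb.le, ← div_eq_mul_inv, div_le_iff₀ (Real.rpow_pos_of_pos hb _)]
      exact ht
    have hnn : 0 ≤ K * Real.exp (-((1 - α) * ρ * g.dist a b)) * g.len a ^ (-(1 + β)) :=
      mul_nonneg (mul_nonneg hK0 (Real.exp_nonneg _)) (Real.rpow_nonneg ha.le _)
    calc K * Real.exp (-(ρ * g.dist a b)) * g.len a ^ (-(β - 1)) * g.len b ^ (-2 : ℝ)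
        = K * Real.exp (-((1 - α) * ρ * g.dist a b)) * g.len a ^ (-(1 + β)) *
            (Real.exp (-(α * ρ * g.dist a b)) * g.len a ^ (2 : ℝ) * g.len b ^ (-2 : ℝ)) := by rw [hsplitA, hsplit]; ring
      _ ≤ K * Real.exp (-((1 - α) * ρ * g.dist a b)) * g.len a ^ (-(1 + β)) * Λ := mul_le_mul_of_nonneg_left hratio hnn
      _ = K * Λ * g.len a ^ (-(1 + β)) * Real.exp (-((1 - α) * ρ * g.dist a b)) := by ring
  have hA := hasMajorantHom_mono (g := toB6 g R₀ H₀) blkZ 𝔭.blkPY h' hbound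
  have hA' : HasMajorantHom (g := toB6 g R₀ H₀) blkZ 𝔭.blkPY (𝔭.ΦY U β ∘ₗ (Dop ∘ₗ Hop))
      (fun a b => K * Λ * g.len a ^ (-(1 + β)) * Real.exp (-((1 - α) * ρ * g.dist a b))) := hA
  have hδ : 0 ≤ (1 - α) * ρ := mul_nonneg (by linarith) hρ
  have h := hkh_le_of_hasMajorantHom_nbr (R₀ := R₀) (H₀ := H₀) hC hG.lenpos hCL1 hCL hG.tri hG.symm hβ0 hβ1 (mul_nonneg hK0 hΛ) hδ
    hA' y' hζ
  calc Hk.h U β ζ y' ≤ (CL ^ 2 * Real.exp (r * ((1 - α) * ρ)) * (K * Λ)) * g.len y ^ (-(1 + β)) *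
        Real.exp (-((1 - α) * ρ * g.dist y y')) * (g.len y') ^ (-(d : ℝ)) * g.cutH β ζ := h
    _ = (CL ^ 2 * Real.exp (r * ((1 - α) * ρ)) * (K * Λ)) * g.cutH β ζ * (g.len y) ^ (-(1 + β)) * (g.len y') ^ (-(d : ℝ)) *
        Real.exp (-((1 - α) * ρ * g.dist y y')) := by ring

end HState

end

end Literature.MathematicalPhysics.QuantumFieldTheory.Balaban1983to89.B9Thm312WholeBlocksRegular
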